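import Summits.ResolutionOfSingularities.ResolutionOfSingularities.Theorems.FrobeniusClosingPatchingRelPerfectDepthGradedFormatInitial
import Summits.ResolutionOfSingularities.ResolutionOfSingularities.Theorems.FrobeniusClosingPatchingRelPerfectDepthExceptionalPackagePow
import Summits.ResolutionOfSingularities.ResolutionOfSingularities.Theorems.FrobeniusClosingPatchingRelPerfectMonomialFormat
import HarnessLib

/-!
# Crux `PatchingRelPerfect` (stmt-ResolutionOfSingularities-16161), chain w52 — R4 X-side, the GRADED
# INITIAL PACKAGE (D): retraction + graded format `K = r^*𝔟 ⊔ 𝓘_E^ℓ` for `I = (F) + J` over a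
# coefficient field

[OURS · L1 W5.2 · rung tool] res-L1-w52-plan-1 g6 RATIFY 2026-08-27 «res-D-pv-055 (D) initial retraction +
graded format for `I = (F) + J` over a COEFFICIENT FIELD — GO (state the coefficient field as data
`(σ : IsLocalRing.ResidueField S →+* S) (hσ : ∀ a, IsLocalRing.residue S (σ a) = a)`)», in the shape of
res-L1-w52-lead-1 g3's retraction format `GradedFormat` at the initial state (`U = ⊤`).  This file
ASSEMBLES the companions `…DepthGradedRetraction` (the retraction `r : X₁ → E`, `i ≫ r = 𝟙`,
`r ≫ (i ≫ r₀) = r₀`), `…DepthGradedFormatInitial` (the format `(F(y))𝒪_{X₁} = 𝓘_Eᵉ · 𝔟̃` and the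
conicity `π^*𝔟̃ = 𝔟̃` for `π ≫ r₀ = r₀`) and `…DepthExceptionalPackagePow` (the `E`-side properties):

Let `S` be regular local with regular system of parameters `y = (y₀, …, y_m)`, `κ₀ → S` a coefficient
field (`κ₀ → S/𝔪` bijective), `F ∈ κ₀[T₀, …, T_m]` a form of degree `e`, `ℓ ≥ 1`, and `J` an ideal with
`(y_i^{e+ℓ})_i ⊆ J ⊆ 𝔪^{e+ℓ}`; put `I = (F(y)) + J`.  On `X₁ = Bl_𝔪 Spec S ⊃ E = V(𝔪𝒪_{X₁}) ≅ ℙᵐ_{κ₀}`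
(`i = ι_E`, `g = π`):

* `gradedPackage_model` — there are a retraction `r : X₁ → E` (`i ≫ r = 𝟙_E`) and a LOCALLY PRINCIPAL
  ideal `𝔟 ⊆ 𝒪_E` (the hypersurface `V(F) ⊂ E = ℙᵐ`, as the restriction of the zero scheme `𝔟̃` of the
  pulled-back form) such that with **`K := r^*𝔟 ⊔ 𝓘_E^ℓ`** the depth-`ℓ` invariant
  `DepthTargets.DepthInvariant ℓ S I E X₁ i g K` holds — in particular the FORMAT `I𝒪_{X₁} = 𝓘_Eᵉ · K`
  (from `J𝒪 = 𝓘_E^{e+ℓ}`, `(F(y))𝒪 = 𝓘_Eᵉ 𝔟̃` and the conicity `r^*(𝔟̃|_E) = 𝔟̃`) and the literal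
  maximal contact `𝓘_E^ℓ ≤ K` — together with `K|_E = 𝔟`, and `E` integral, Noetherian, excellent,
  of dimension `m`, locally of finite type over the residue field;
* `gradedPackage_coefficientField` — the same with the coefficient field given as DATA `(σ, hσ)`
  (`κ₀ = S/𝔪`, `I = (F^σ(y)) + J`), via `bijective_algebraMap_of_coefficientField`;
* `isLocallyPrincipal_zeroIdeal` — the remaining chart-level ingredient (`𝔟̃` is locally principal).

Rung tool of OUR route (Kollár (3.111) Step 3 format on the first blow-up, graded over the tangent
cone); nothing here is a statement of the manuscript under review.

## References

* U. Görtz, T. Wedhorn, *Algebraic Geometry I*, 2nd ed. (2020), Remark 11.27, (13.13), Def. 13.90.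
  [GortzWedhorn2020]
* J. Kollár, *Lectures on Resolution of Singularities* (2007), (3.111) Step 3. [Kollar2007]
* R. Hartshorne, *Algebraic Geometry* (1977), II Thm. 7.1 (a), Thm. 8.24 (b). [Hartshorne1977]
-/

-- `Summit.<Summit>.<Sub>.Theorems` with `Sub = Summit` (single-conjunct summit, D-0017)

set_option linter.dupNamespace false

noncomputable section

open CategoryTheory CategoryTheory.Limits AlgebraicGeometry Literature.AlgebraicGeometry.Resolution
open IsLocalRing TopologicalSpace HomogeneousLocalization
open Literature.AlgebraicGeometry.Motives Literature.AlgebraicGeometry.Motives.ProjBaseChangeRing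

-- The standard gradings of polynomial rings are `def`s in Mathlib; as in the Literature files
-- `Resolution/ExceptionalDivisorProjCharts`, `Motives/ProjBaseChangeAny` they are switched on locally.
attribute [local instance] MvPolynomial.gradedAlgebra

namespace Summit.ResolutionOfSingularities.ResolutionOfSingularities.Theorems

namespace DepthOne

universe u

section Chart

variable {S : Type u} [CommRing S] {m : ℕ} (y : Fin (m + 1) → S)
  (κ₀ : Type u) [Field κ₀] [Algebra κ₀ S]

local notation3 "M" => Ideal.span (Set.range y)
local notation3 "X₁" => affineBlowup (Ideal.span (Set.range y))
local notation3 "g" => affineBlowup.π (Ideal.span (Set.range y))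
/-- `r₀` written out (as in `…DepthGradedRetraction`). -/
local notation3 "R₀" => (Proj.map (reesPresentation y) (irrelevant_le_map_reesPresentation y) ≫
  Proj.map (mapGraded κ₀ S (Fin (m + 1))) (irrelevant_le_map κ₀ S (Fin (m + 1))) :
    affineBlowup (Ideal.span (Set.range y)) ⟶ ProjSpace.P m κ₀)
/-- the `κ₀`-structure of `X₁` -/
local notation3 "F₀" => (affineBlowup.π (Ideal.span (Set.range y)) ≫
  Spec.map (CommRingCat.ofHom (algebraMap κ₀ S)) : affineBlowup (Ideal.span (Set.range y)) ⟶ Spec (.of κ₀))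

/-! ### Local principality of the zero scheme -/

/-- The zero scheme `𝔟̃` of the pulled-back form is locally principal (on the chart `D₊(y_j t)` it is
generated by its chart value). [cite: GortzWedhorn2020, Remark 11.27] -/
theorem isLocallyPrincipal_zeroIdeal [IsNoetherianRing S] {e : ℕ} (F : MvPolynomial (Fin (m + 1)) κ₀)
    (hF : F.IsHomogeneous e) :
    IsLocallyPrincipal ((GeneratingSections.ofHom R₀).secOfForm F₀ F hF).zeroIdeal := by
  haveI : IsNoetherian (affineBlowup (M)) := isNoetherian_of_isBlowup (affineBlowup.isBlowup (M))
  have hU := isAffineOpen_ofHom_retraction₀_U y κ₀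
  intro x
  have hx : x ∈ (⨆ j, GeneratingSections.preU (k := κ₀) R₀ j) := by
    rw [GeneratingSections.iSup_preU]; trivial
  obtain ⟨j, hj⟩ := Opens.mem_iSup.mp hx
  exact ⟨⟨_, hU j⟩, hj, _, ((GeneratingSections.ofHom R₀).secOfForm F₀ F hF).ideal_zeroIdeal_self hU j⟩

end Chart

/-! ## The graded initial PACKAGE -/

section Package

variable {S : Type u} [CommRing S] [IsRegularLocalRing S] {m : ℕ} (y : Fin (m + 1) → S)
  (hy : Ideal.span (Set.range y) = IsLocalRing.maximalIdeal S)
  (hd : (IsLocalRing.maximalIdeal S).spanFinrank = m + 1)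
  (κ₀ : Type u) [Field κ₀] [Algebra κ₀ S]
  (hκ : Function.Bijective (algebraMap κ₀ (S ⧸ Ideal.span (Set.range y))))

local notation3 "M" => Ideal.span (Set.range y)
local notation3 "X₁" => affineBlowup (Ideal.span (Set.range y))
local notation3 "g" => affineBlowup.π (Ideal.span (Set.range y))
local notation3 "𝓔" => (affineBlowup.idealSheaf (Ideal.span (Set.range y))).comap
  (affineBlowup.π (Ideal.span (Set.range y)))
local notation3 "R₀" => (Proj.map (reesPresentation y) (irrelevant_le_map_reesPresentation y) ≫
  Proj.map (mapGraded κ₀ S (Fin (m + 1))) (irrelevant_le_map κ₀ S (Fin (m + 1))) :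
    affineBlowup (Ideal.span (Set.range y)) ⟶ ProjSpace.P m κ₀)
local notation3 "F₀" => (affineBlowup.π (Ideal.span (Set.range y)) ≫
  Spec.map (CommRingCat.ofHom (algebraMap κ₀ S)) : affineBlowup (Ideal.span (Set.range y)) ⟶ Spec (.of κ₀))

include hy hd hκ in
/-- **THE GRADED INITIAL PACKAGE at the model** (plan-1 g6 RATIFY (D); lead-1's retraction model at the
initial state, `U = ⊤`).  For `S` regular local with regular system of parameters `y = (y₀, …, y_m)`, a
coefficient field `κ₀ → S` (`κ₀ → S/𝔪` bijective), a FORM `F ∈ κ₀[T]` of degree `e` and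
`(y_i^{e+ℓ}) ⊆ J ⊆ 𝔪^{e+ℓ}` (`ℓ ≥ 1`), put `I = (F(y)) + J`.  Then on `X₁ = Bl_𝔪 Spec S ⊃ E = V(𝔪𝒪)`
(`i = subschemeι`) there are the retraction `r : X₁ → E` (`i ≫ r = 𝟙`) and a locally principal ideal
`𝔟 ⊆ 𝒪_E` (the restriction of the zero scheme of `F`, i.e. the hypersurface `V(F̄) ⊂ E ≅ ℙᵐ`) such that,
with **`K := r^*𝔟 ⊔ 𝓘_E^ℓ`**: `DepthTargets.DepthInvariant ℓ S I E X₁ i g K` holds (format `I𝒪 = 𝓘_Eᵉ · K`,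
literal maximal contact `𝓘_E^ℓ ≤ K`, …), `K|_E = 𝔟`, and `E` is integral, Noetherian, excellent, of
dimension `m`, locally of finite type over the residue field. [cite: GortzWedhorn2020, Def. 13.90, (13.13)]
[cite: Kollar2007, (3.111) Step 3] [cite: Hartshorne1977, II Thm. 7.1 (a), Thm. 8.24 (b)] -/
theorem gradedPackage_model {e ℓ : ℕ} (hℓ : 1 ≤ ℓ) (F : MvPolynomial (Fin (m + 1)) κ₀)
    (hF : F.IsHomogeneous e) (J : Ideal S)
    (hJ₁ : Ideal.span (Set.range fun i => y i ^ (e + ℓ)) ≤ J) (hJ₂ : J ≤ IsLocalRing.maximalIdeal S ^ (e + ℓ)) :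
    ∃ (r : X₁ ⟶ (𝓔).subscheme) (𝔟 : ((𝓔).subscheme).IdealSheafData),
      (𝓔).subschemeι ≫ r = 𝟙 _ ∧
      DepthTargets.DepthInvariant ℓ S (Ideal.span {MvPolynomial.aeval y F} ⊔ J) (𝓔).subscheme (X₁)
        (𝓔).subschemeι (g) (𝔟.comap r ⊔ (𝓔) ^ ℓ) ∧
      (𝔟.comap r ⊔ (𝓔) ^ ℓ).comap (𝓔).subschemeι = 𝔟 ∧ IsLocallyPrincipal 𝔟 ∧
      IsIntegral (𝓔).subscheme ∧ IsNoetherian (𝓔).subscheme ∧ Scheme.IsExcellent (𝓔).subscheme ∧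
      topologicalKrullDim (𝓔).subscheme = m ∧
      ∃ q : (𝓔).subscheme ⟶ Spec (.of (IsLocalRing.ResidueField S)), LocallyOfFiniteType q := by
  have hqr : IsQuasiRegular y := isQuasiRegular_regularSystemOfParameters hd y hy
  obtain ⟨r, hr1, hr2, -⟩ := exists_retraction y κ₀ hqr hκ
  -- the zero scheme of `F`, its conicity, and the format
  set 𝔟t := ((GeneratingSections.ofHom R₀).secOfForm F₀ F hF).zeroIdeal with h𝔟t
  have hcon : (𝔟t.comap (𝓔).subschemeι).comap r = 𝔟t := by
    rw [← Scheme.IdealSheafData.comap_comp]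
    exact zeroIdeal_comap_eq_of_comp_eq y κ₀ F hF (r ≫ (𝓔).subschemeι) (by rw [Category.assoc]; exact hr2)
  have hfmtF := comap_idealSheaf_span_aeval_eq y κ₀ F hF
  have hJ : (affineBlowup.idealSheaf J).comap g = (𝓔) ^ (e + ℓ) := by
    apply le_antisymm
    · rw [← comap_pow, ← idealSheaf_pow]
      exact Scheme.IdealSheafData.comap_mono _ (affineBlowup.idealSheaf_le_idealSheaf_iff.mpr (hy ▸ hJ₂))
    · rw [← comap_idealSheaf_span_powers_eq_pow y rfl (affineBlowup.isBlowup (M)) (by omega : 1 ≤ e + ℓ)]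
      exact Scheme.IdealSheafData.comap_mono _ (affineBlowup.idealSheaf_le_idealSheaf_iff.mpr hJ₁)
  have hfmt : (affineBlowup.idealSheaf (Ideal.span {MvPolynomial.aeval y F} ⊔ J)).comap g =
      (𝓔) ^ e * (𝔟t ⊔ (𝓔) ^ ℓ) := by
    rw [DepthTargets.idealSheaf_sup_eq, Scheme.IdealSheafData.comap_sup, hfmtF, hJ, pow_add]
    simpa only [add_eq_sup] using (mul_add ((𝓔) ^ e) 𝔟t ((𝓔) ^ ℓ)).symm
  refine ⟨r, 𝔟t.comap (𝓔).subschemeι, hr1, ?_, ?_, ?_, isIntegral_exceptional y hy hd,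
    isNoetherian_exceptional y, isExcellent_exceptional y hy, topologicalKrullDim_exceptional y hy hd, ?_⟩
  · -- the invariant
    rw [hcon]
    exact ⟨isNoetherian_blowup y, isRegular_blowup y hy, isRegular_exceptional y hy hd, inferInstance,
      ker_subschemeι_isEffectiveCartier y, map_exceptional_eq_closedPoint y hy,
      ⟨_, affineBlowup.isBlowup (M), support_idealSheaf_span_subset y hy⟩,
      by rw [Scheme.IdealSheafData.ker_subschemeι]; exact le_sup_right,
      ⟨_, (affineBlowup.isBlowup (M)).isEffectiveCartier.pow e, hfmt⟩⟩
  · -- restriction to `E`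
    have hEi : ((𝓔) ^ ℓ).comap (𝓔).subschemeι = ⊥ := by
      have h := comap_ker_self (𝓔).subschemeι
      rw [Scheme.IdealSheafData.ker_subschemeι] at h
      rw [comap_pow, h, ← Scheme.IdealSheafData.zero_eq_bot, zero_pow (by omega : ℓ ≠ 0)]
    rw [Scheme.IdealSheafData.comap_sup, ← Scheme.IdealSheafData.comap_comp, hr1,
      Scheme.IdealSheafData.comap_id, hEi, sup_bot_eq]
  · exact (isLocallyPrincipal_zeroIdeal y κ₀ F hF).comap _
  · obtain ⟨q, hq⟩ := exists_hom_exceptional_residueField' y hy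
    exact ⟨q, locallyOfFiniteType_of_fac y hq⟩

omit [Algebra κ₀ S] [Field κ₀] in
include hy in
/-- A coefficient field `σ : S/𝔪 → S` (a ring section of `residue`) makes `S/𝔪 → S/(y) = S/𝔪` bijective.
[folklore] -/
theorem bijective_algebraMap_of_coefficientField (σ : IsLocalRing.ResidueField S →+* S)
    (hσ : ∀ a, IsLocalRing.residue S (σ a) = a) :
    letI : Algebra (IsLocalRing.ResidueField S) S := σ.toAlgebra
    Function.Bijective (algebraMap (IsLocalRing.ResidueField S) (S ⧸ M)) := by
  letI : Algebra (IsLocalRing.ResidueField S) S := σ.toAlgebra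
  haveI : Nontrivial (S ⧸ M) :=
    Ideal.Quotient.nontrivial_iff.mpr (by rw [hy]; exact (IsLocalRing.maximalIdeal.isMaximal S).ne_top)
  refine ⟨(algebraMap (IsLocalRing.ResidueField S) (S ⧸ M)).injective, fun q => ?_⟩
  obtain ⟨s, rfl⟩ := Ideal.Quotient.mk_surjective q
  refine ⟨IsLocalRing.residue S s, ?_⟩
  rw [← Ideal.Quotient.mk_comp_algebraMap, RingHom.comp_apply, RingHom.algebraMap_toAlgebra,
    Ideal.Quotient.eq, hy, ← IsLocalRing.residue_eq_zero_iff, map_sub, hσ, sub_self]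

include hy hd in
/-- **THE GRADED INITIAL PACKAGE over a COEFFICIENT FIELD** (plan-1 g6 RATIFY (D): «state the coefficient
field as data `(σ, hσ)`»; its existence for complete `S` with perfect residue field is
`exists_coefficientField_of_perfect`, res-D-pv-052).  Same conclusion as `gradedPackage_model` with
`κ₀ = S/𝔪`, the form `F ∈ (S/𝔪)[T₀, …, T_m]` evaluated through `σ`: `I = (F^σ(y)) + J`.
[cite: GortzWedhorn2020, Def. 13.90, (13.13)] [cite: Kollar2007, (3.111) Step 3] -/
theorem gradedPackage_coefficientField (σ : IsLocalRing.ResidueField S →+* S)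
    (hσ : ∀ a, IsLocalRing.residue S (σ a) = a) {e ℓ : ℕ} (hℓ : 1 ≤ ℓ)
    (F : MvPolynomial (Fin (m + 1)) (IsLocalRing.ResidueField S)) (hF : F.IsHomogeneous e) (J : Ideal S)
    (hJ₁ : Ideal.span (Set.range fun i => y i ^ (e + ℓ)) ≤ J) (hJ₂ : J ≤ IsLocalRing.maximalIdeal S ^ (e + ℓ)) :
    ∃ (r : X₁ ⟶ (𝓔).subscheme) (𝔟 : ((𝓔).subscheme).IdealSheafData),
      (𝓔).subschemeι ≫ r = 𝟙 _ ∧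
      DepthTargets.DepthInvariant ℓ S (Ideal.span {MvPolynomial.eval₂ σ y F} ⊔ J) (𝓔).subscheme (X₁)
        (𝓔).subschemeι (g) (𝔟.comap r ⊔ (𝓔) ^ ℓ) ∧
      (𝔟.comap r ⊔ (𝓔) ^ ℓ).comap (𝓔).subschemeι = 𝔟 ∧ IsLocallyPrincipal 𝔟 ∧
      IsIntegral (𝓔).subscheme ∧ IsNoetherian (𝓔).subscheme ∧ Scheme.IsExcellent (𝓔).subscheme ∧
      topologicalKrullDim (𝓔).subscheme = m ∧
      ∃ q : (𝓔).subscheme ⟶ Spec (.of (IsLocalRing.ResidueField S)), LocallyOfFiniteType q := by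
  letI : Algebra (IsLocalRing.ResidueField S) S := σ.toAlgebra
  have h := gradedPackage_model y hy hd (IsLocalRing.ResidueField S)
    (bijective_algebraMap_of_coefficientField y hy σ hσ) hℓ F hF J hJ₁ hJ₂
  have haev : MvPolynomial.aeval y F = MvPolynomial.eval₂ σ y F := by
    rw [MvPolynomial.aeval_def, RingHom.algebraMap_toAlgebra]
  rwa [haev] at h

end Package

end DepthOne

end Summit.ResolutionOfSingularities.ResolutionOfSingularities.Theorems

end
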